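import Mathlib
import Summits.BirchSwinnertonDyer.BirchSwinnertonDyer.Theorems.ResidualThetaTransportAtTwoSignedMuSeedAtTwoPlusNonsquareDescentCoherentLimit
import Summits.BirchSwinnertonDyer.BirchSwinnertonDyer.Theorems.ResidualThetaTransportAtTwoSignedMuSeedAtTwoPlusNonsquareDescentLimitBookkeeping
import HarnessLib

/-!
# Non-square descent — IWASAWA'S KERNEL IN THE LIMIT: `ker pr_k = ω_k X` for the norm-coherent limit `X = lim_← A_j` from the FINITE-LEVEL
# kernels `ker(A_j → A_k) ⊆ ω_k A_j` (König on finite levels) — the glue between the tree's finite-level theorem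
# `Literature.NumberTheory.NumberFields.ClassGroupNormKernel.ker_classGroupNorm_eq_closure_of_ramificationIdx_eq_finrank` (`ker N_{F/B} = I_G Cl(F)`
# for one totally ramified prime) and the hypotheses `hkn`/`hkm` of `…NonsquareDescentCapitulationViaLimit` (line `nonsquare-descent`, stub S2) —
# seed crux `SignedMuSeedAtTwoPlus` stmt-BirchSwinnertonDyer-21438 (parent Kμ⁺ `SignedMuVanishingAtTwoPlus` stmt-BirchSwinnertonDyer-20689,
# route ResidualThetaTransportAtTwo), line card `Cruxes/SignedMuSeedAtTwoPlus/Lines/nonsquare-descent.md`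

Cell `bsd-wall`, width seat `bsd-wall-rtt-p4-w2` g20 (`--supports`, closes nothing).  THEOREMS ONLY; BSD is not proved by this and nothing
arithmetic is asserted: module algebra over a commutative ring (König's lemma enters through g18's `…LimitBookkeeping`).

Dictionary (nothing below depends on it).  `E j = A_{n+j}^χ` (finite), `N j : E (j+1) → E j` the norms, `Nc j i` their composites (conventions of
`…UnitsModUniversalNorms`: `Nc j j = id`, `Nc (j+1) i = Nc j i ∘ N j`), `X = Einf` with projections `π j` (`hπ` compatible, `hlift` complete,
`hinj` jointly injective — all three automatic for the coherent-sequence model of `…CoherentLimit`), `ω = ω_{n+k} ∈ Λ'`.  The tree's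
`ClassGroupNormKernel.classGroupNorm_eq_one_iff_of_zpowers_eq_top` (Washington §13.3 L.13.15 / Prop. 13.22 at finite level) gives, for each pair
of layers `K_{n+k} ⊆ K_{n+j}` of a `ℤ_p`-tower with one totally ramified prime, `ker(N : A_{n+j} → A_{n+k}) = (γ^{p^{n+k}} − 1) A_{n+j} = ω_{n+k} A_{n+j}`;
this file turns that FINITE-LEVEL statement into the LIMIT statement `ker π_k = ω_k X` that `…CapitulationViaLimit.natCard_ker_extend_le` consumes
(its `hkn`, `hkm`):

* §1 `Nc_proj_eq` — `Nc j i (π j x) = π i x` (the projections form a norm-chain of every length).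
* §2 **`ker_proj_eq_smul_top`** — if `ker (Nc j k) ≤ ω • E j` for all `j ≥ k` and `ω • E k = 0`, then `ker (π k) = ω • X`, for `X` a compatible
  complete jointly-injective limit of levels with FINITE `ω`-torsion (e.g. finite levels); KÖNIG is g18's `…LimitBookkeeping.exists_coherent_smul_eq`
  (a coherent sequence divisible by `ω` levelwise is `ω •` a coherent sequence; Mathlib `nonempty_sections_of_finite_inverse_system`);
  `ker_proj_eq_smul_top'` — from the exact finite-level kernels `ker (Nc j k) = ω • E j`.
* §3 **`ker_proj_coherent_eq_smul_top`** — the same for the coherent-sequence model `S ≤ Π_j E j` of `…CoherentLimit` (all structure hypotheses free,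
  `proj_coherent_inj`).

[folklore]
-/

set_option autoImplicit false
-- the Theorems namespace of this sub repeats the summit name by design (D-0017 nested layout)
set_option linter.dupNamespace false

open scoped Pointwise

namespace Summit.BirchSwinnertonDyer.BirchSwinnertonDyer.Theorems.SignedMuAtTwo.NonsquareDescent

universe u v w

variable {R : Type u} [CommRing R] (E : ℕ → Type v) [∀ i, AddCommGroup (E i)] [∀ i, Module R (E i)]
  (N : ∀ i, E (i + 1) →ₗ[R] E i) (Nc : ∀ j i, E j →ₗ[R] E i)

/-! ## §1 Composites along the projections -/

section Koenig

variable {Einf : Type w} [AddCommGroup Einf] [Module R Einf] (π : ∀ i, Einf →ₗ[R] E i)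

/-- `Nc j i (π j x) = π i x` for `i ≤ j`: the projections of a compatible limit form a norm-chain of every length. [folklore] -/
theorem Nc_proj_eq (hNc0 : ∀ j, Nc j j = LinearMap.id) (hNcS : ∀ j i, i ≤ j → Nc (j + 1) i = Nc j i ∘ₗ N j)
    (hπ : ∀ i e, N i (π (i + 1) e) = π i e) (x : Einf) {j i : ℕ} (hij : i ≤ j) : Nc j i (π j x) = π i x :=
  Nc_apply_chain E N Nc hNc0 hNcS j (fun i => π i x) (fun i _ => hπ i x) i hij

end Koenig

/-! ## §2 `ker π_k = ω • X` from the finite-level kernels -/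

section Limit

variable {Einf : Type w} [AddCommGroup Einf] [Module R Einf] (π : ∀ i, Einf →ₗ[R] E i)

/-- **IWASAWA'S KERNEL IN THE LIMIT: `ker π_k = ω • X`.**  Let `X = Einf` be a compatible (`hπ`), complete (`hlift`) and
jointly injective (`hinj`) limit with projections `π j`, `Nc` the composite norms.  If at every level `j ≥ k` the kernel of `Nc j k : E j → E k` consists
of `ω`-multiples (the FINITE-LEVEL theorem: `ker(A_{n+j} → A_{n+k}) = ω_{n+k} A_{n+j}`, tree
`ClassGroupNormKernel.classGroupNorm_eq_one_iff_of_zpowers_eq_top`) and `ω` kills `E k` (`ω_{n+k} A_{n+k} = 0`), then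
`ker (π k) = ω • X` — Washington's `A_k ≅ X/ω_k X` (the hypotheses `hkn`, `hkm` of `…CapitulationViaLimit`); the levels need only have finite
`ω`-torsion (`hfin`, e.g. finite levels).  Proof: for `x ∈ ker π_k` the sequence `(π j x)_j` is coherent and an `ω`-multiple at every level
(`j ≥ k` by hypothesis, `j < k` because `π j x = Nc k j (π k x) = 0`); König (g18's `…LimitBookkeeping.exists_coherent_smul_eq`) writes it as
`ω • b` with `b` coherent, `hlift` realises `b = (π j y)_j`, and `hinj` gives `x = ω • y`.
[cite: Washington1997, §13.3 Lemma 13.15 and Prop. 13.22 (`A_n ≃ X/ω_n X`)] [folklore] -/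
theorem ker_proj_eq_smul_top (hNc0 : ∀ j, Nc j j = LinearMap.id)
    (hNcS : ∀ j i, i ≤ j → Nc (j + 1) i = Nc j i ∘ₗ N j) (hπ : ∀ i e, N i (π (i + 1) e) = π i e)
    (hlift : ∀ x : ∀ i, E i, (∀ i, N i (x (i + 1)) = x i) → ∃ e : Einf, ∀ i, π i e = x i)
    (hinj : ∀ e : Einf, (∀ i, π i e = 0) → e = 0) (k : ℕ) {ω : R} (hfin : ∀ i, Finite {y : E i // ω • y = 0})
    (hker : ∀ j, k ≤ j → ∀ y : E j, Nc j k y = 0 → ∃ b : E j, ω • b = y) (hω : ∀ y : E k, ω • y = 0) :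
    LinearMap.ker (π k) = ω • (⊤ : Submodule R Einf) := by
  apply le_antisymm
  · intro x hx
    rw [LinearMap.mem_ker] at hx
    -- every `π j x` is an `ω`-multiple
    have hex : ∀ j, ∃ b : E j, ω • b = π j x := by
      intro j
      rcases le_or_gt k j with hkj | hjk
      · exact hker j hkj (π j x) (by rw [Nc_proj_eq E N Nc π hNc0 hNcS hπ x hkj, hx])
      · exact ⟨0, by rw [smul_zero, ← Nc_proj_eq E N Nc π hNc0 hNcS hπ x hjk.le, hx, map_zero]⟩
    obtain ⟨b, hbN, hb⟩ := exists_coherent_smul_eq E N ω hfin (fun j => π j x) (fun i => hπ i x) hex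
    obtain ⟨y, hy⟩ := hlift b hbN
    have hxy : x = ω • y := by
      rw [← sub_eq_zero]
      refine hinj _ fun i => ?_
      rw [map_sub, map_smul, hy i, hb i, sub_self]
    rw [hxy]
    exact Submodule.smul_mem_pointwise_smul y ω ⊤ Submodule.mem_top
  · rintro _ ⟨y, -, rfl⟩
    rw [LinearMap.mem_ker, DistribSMul.toLinearMap_apply, map_smul, hω]

/-- The two-sided form used downstream: `ker π_k = ω • X` from the EXACT finite-level kernels `ker (Nc j k) = ω • E j` (`j ≥ k`).
[cite: Washington1997, §13.3 Lemma 13.15 and Prop. 13.22] [folklore] -/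
theorem ker_proj_eq_smul_top' (hNc0 : ∀ j, Nc j j = LinearMap.id)
    (hNcS : ∀ j i, i ≤ j → Nc (j + 1) i = Nc j i ∘ₗ N j) (hπ : ∀ i e, N i (π (i + 1) e) = π i e)
    (hlift : ∀ x : ∀ i, E i, (∀ i, N i (x (i + 1)) = x i) → ∃ e : Einf, ∀ i, π i e = x i)
    (hinj : ∀ e : Einf, (∀ i, π i e = 0) → e = 0) (k : ℕ) {ω : R} (hfin : ∀ i, Finite {y : E i // ω • y = 0})
    (hker : ∀ j, k ≤ j → LinearMap.ker (Nc j k) = ω • (⊤ : Submodule R (E j))) :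
    LinearMap.ker (π k) = ω • (⊤ : Submodule R Einf) := by
  refine ker_proj_eq_smul_top E N Nc π hNc0 hNcS hπ hlift hinj k hfin (fun j hkj y hy => ?_) (fun y => ?_)
  · have hy' : y ∈ ω • (⊤ : Submodule R (E j)) := by rw [← hker j hkj, LinearMap.mem_ker]; exact hy
    obtain ⟨b, -, rfl⟩ := hy'
    exact ⟨b, rfl⟩
  · -- at level `k`: `Nc k k = id`, so `ω • E k = ker id = 0`
    have h : ω • y ∈ LinearMap.ker (Nc k k) := by
      rw [hker k le_rfl]; exact Submodule.smul_mem_pointwise_smul y ω ⊤ Submodule.mem_top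
    rw [LinearMap.mem_ker, hNc0, LinearMap.id_apply] at h
    exact h

end Limit

/-! ## §3 The coherent-sequence model -/

section Coherent

variable {E N}
variable {S : Submodule R (∀ i, E i)} (hS : ∀ x : ∀ i, E i, x ∈ S ↔ ∀ i, N i (x (i + 1)) = x i)
include hS

/-- `hinj` for the coherent-sequence model: a coherent sequence all of whose terms vanish is zero. [folklore] -/
theorem proj_coherent_inj (e : S) (he : ∀ i, ((LinearMap.proj i : (∀ j, E j) →ₗ[R] E i) ∘ₗ S.subtype) e = 0) : e = 0 := by
  have _ := hS
  apply Subtype.ext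
  funext i
  exact he i

/-- **`ker π_k = ω • S` for the coherent-sequence model** `S ≤ Π_j E j` of the norm-coherent limit (levels with finite `ω`-torsion): from the finite-level kernels
`ker (Nc j k) = ω • E j` (`j ≥ k`). [cite: Washington1997, §13.3 Lemma 13.15 and Prop. 13.22] [folklore] -/
theorem ker_proj_coherent_eq_smul_top (Nc : ∀ j i, E j →ₗ[R] E i) (hNc0 : ∀ j, Nc j j = LinearMap.id)
    (hNcS : ∀ j i, i ≤ j → Nc (j + 1) i = Nc j i ∘ₗ N j) (k : ℕ) {ω : R} (hfin : ∀ i, Finite {y : E i // ω • y = 0})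
    (hker : ∀ j, k ≤ j → LinearMap.ker (Nc j k) = ω • (⊤ : Submodule R (E j))) :
    LinearMap.ker ((LinearMap.proj k : (∀ j, E j) →ₗ[R] E k) ∘ₗ S.subtype) = ω • (⊤ : Submodule R S) :=
  ker_proj_eq_smul_top' E N Nc (fun i => (LinearMap.proj i : (∀ j, E j) →ₗ[R] E i) ∘ₗ S.subtype) hNc0 hNcS
    (proj_coherent_compat hS) (proj_coherent_lift hS) (proj_coherent_inj hS) k hfin hker

end Coherent

end Summit.BirchSwinnertonDyer.BirchSwinnertonDyer.Theorems.SignedMuAtTwo.NonsquareDescent
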